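import Literature.AnabelianGeometry.AbsoluteAnabelian.GaloisPadicLogShellBridge
import Literature.IUT.LogVolume.LogUnitsSubmodule
import Mathlib.Algebra.Ring.AddAut
import HarnessLib

/-!
# The `ℤ_p^×`-powers on `k~ = 𝒪_k̄^× ⧸ 𝒪_k̄^μ` via `log_k̄`, and the lattices `log_k̄((𝒪_k̄^×)^H)`

S. Mochizuki, *Inter-universal Teichmüller theory II*, §1, Example 1.8 (iv), kurims manuscript (Dec. 2020)
p. 39 [claim: Mochizuki2012, status: disputed] (IUTchII §1 Ex 1.8 (iv), kurims p.39): "`Ism(G)` … the compact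
topological group of `G`-isometries of `O^{×μ}(G)`, i.e., `G`-equivariant automorphisms of the ind-topological
module `O^{×μ}(G)` that, for each open subgroup `H ⊆ G`, preserve the lattice in `O^{×μ}(G)^H` determined by the
image of `O^×(G)^H`", "the natural homomorphism `Ẑ^× ↠ ℤ_p^× ↪ Ism`"; Remark 1.11.1 (i) (d) p. 50: "the underlying
ind-topological module of `O^{×μ}(G)` is divisible, hence admits a natural action by `ℚ_p`"; and S. Mochizuki,
*Topics in absolute anabelian geometry III*, §3, proof of Prop. 3.3 (ii), kurims p. 74 [MochizukiAbsTopIII2015]: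
"there is a natural action of `Ẑ^×` on `M`" (`M = 𝒪_k̄^×`, `T = TCG`).

For the GENUINE objects — an MLF `k` with an algebraic closure `k̄` (abc-iut-L4-t2's `MLFClosure`), the group
`k~ := 𝒪_k̄^× ⧸ 𝒪_k̄^μ` (`unitGroup k k̄ ⧸ torsion`) and the real logarithm `log_k̄ : k~ ⥲ (k̄, +)`
(`MLFClosure.logEquiv`, this lineage) — this file constructs and proves:

* `GaloisPadicLog.scalarAut L : k̄ˣ →* MulAut k~` — multiplication by a non-zero scalar of `k̄` on `(k̄, +)`,
  transported to `k~` along `log_k̄` (the `ℚ_p`-, indeed `k̄`-, vector space structure of the divisible group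
  `k~`, Rmk. 1.11.1 (i) (d)); `logEquiv_scalarAut`; it COMMUTES with the `G_k`-action for `G_k`-fixed scalars
  (`scalarAut_unitsModTorsionGaloisMap`);
* `PadicAlgCl.exists_mem_adjoin_norm_eq_one_log_eq_mul` — in `ℚ̄_p`: for a unit `x` and `a ∈ ℤ_p` there is a unit
  `y ∈ ℚ_p(x)` with `log y = a · log x` (abc-iut-S1's `smul_mem_logUnits`: `log_p(𝒪_E^×)` is a `ℤ_p`-module);
* `MLFClosure.exists_mem_adjoin_unit_log_eq_mul` — the same for `log_k̄` of EVERY `MLFClosure` (transport along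
  the `k`-isomorphism `k̄ ≃ ℚ̄_p` inside `MLFClosure.galoisPadicLog`): **the LATTICE LEMMA** — for every subgroup
  `H ⊆ G_k` (in particular every open one) the lattice `(𝒪_k̄^×)^H ⧸ μ ⊆ k~` is carried onto itself by the
  `ℤ_p^×`-powers (`MLFClosure.exists_fixed_zpPow_mk_eq_mk`);
* `MLFClosure.zpPow C : ℤ_[p]ˣ →* MulAut k~` (`p` the residue characteristic) — **the `ℤ_p^×`-powers
  `x ↦ x^a` on `k~`**, i.e. the second arrow of "`Ẑ^× ↠ ℤ_p^× ↪ Ism`" before co-restriction; `logEquiv_zpPow`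
  (`log_k̄(x^a) = a · log_k̄ x`), `zpPow_unitsModTorsionGaloisMap` (`G_k`-equivariant), `zpPow_injective`.

HONEST FRAMING: classical `p`-adic analysis; record-anchored to a disputed corpus only through the locators;
nothing here bears on [IUTchIII] Cor. 3.12.
-/

set_option autoImplicit false

noncomputable section

namespace Literature.AnabelianGeometry.AbsoluteAnabelian

open ValuativeRel
open scoped ValuativeRel
open Literature.NumberTheory.Transcendental Literature.NumberTheory.GaloisRepresentations
open Literature.IUT.LogVolume

universe u

/-! ## Scalars of `k̄` acting on `k~` through `log_k̄` -/

namespace GaloisPadicLog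

variable {k : Type u} [Field k] [ValuativeRel k] {K : Type u} [Field K] [Algebra k K] (L : GaloisPadicLog k K)

/-- **Multiplication by a non-zero scalar `c ∈ k̄` on `(k̄, +)`, transported to `k~ = 𝒪_k̄^×⧸𝒪_k̄^μ` along
`log_k̄`** ("divisible, hence admits a natural action by `ℚ_p`", [IUTchII] Rmk. 1.11.1 (i) (d); here for every
`c ∈ k̄^×`): a homomorphism `k̄ˣ → Aut(k~)`. [claim: Mochizuki2012, status: disputed] (IUTchII §1 Rmk 1.11.1 (i), kurims p.50) -/
def scalarAut : Kˣ →* MulAut (unitGroup k K ⧸ CommGroup.torsion (unitGroup k K)) :=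
  (MulAut.congr L.logEquiv.symm).toMonoidHom.comp ((MulAutMultiplicative K).symm.toMonoidHom.comp AddAut.mulLeft)

/-- `log_k̄ (c · x) = c * log_k̄ x`: the defining property of `scalarAut`.
[claim: Mochizuki2012, status: disputed] (IUTchII §1 Rmk 1.11.1 (i), kurims p.50) -/
@[simp] theorem logEquiv_scalarAut (c : Kˣ) (x : unitGroup k K ⧸ CommGroup.torsion (unitGroup k K)) :
    L.logEquiv (L.scalarAut c x) = Multiplicative.ofAdd ((c : K) * Multiplicative.toAdd (L.logEquiv x)) := by
  change L.logEquiv (L.logEquiv.symm ((MulAutMultiplicative K).symm (AddAut.mulLeft c) (L.logEquiv x))) = _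
  rw [MulEquiv.apply_symm_apply]
  rfl

/-- `log_k̄ (c · x)` read additively. [claim: Mochizuki2012, status: disputed] (IUTchII §1 Rmk 1.11.1 (i), kurims p.50) -/
theorem toAdd_logEquiv_scalarAut (c : Kˣ) (x : unitGroup k K ⧸ CommGroup.torsion (unitGroup k K)) :
    Multiplicative.toAdd (L.logEquiv (L.scalarAut c x)) = (c : K) * Multiplicative.toAdd (L.logEquiv x) := by
  rw [logEquiv_scalarAut, toAdd_ofAdd]

/-- **The scalar action commutes with the `G_k`-action on `k~`** for every scalar FIXED by `σ ∈ G_k` (e.g. every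
scalar from `k ⊇ ℚ_p`): `c · (σ x) = σ (c · x)` — `log_k̄` is `G_k`-equivariant and `σ` is `k`-linear.
[claim: Mochizuki2012, status: disputed] (IUTchII §1 Ex 1.8 (iv), kurims p.39) -/
theorem scalarAut_unitsModTorsionGaloisMap (σ : K ≃ₐ[k] K) (c : Kˣ) (hc : σ (c : K) = c)
    (x : unitGroup k K ⧸ CommGroup.torsion (unitGroup k K)) :
    L.scalarAut c (unitsModTorsionGaloisMap σ x) = unitsModTorsionGaloisMap σ (L.scalarAut c x) := by
  apply L.logEquiv.injective
  apply Multiplicative.toAdd.injective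
  rw [toAdd_logEquiv_scalarAut, L.logEquiv_unitsModTorsionGaloisMap, L.logEquiv_unitsModTorsionGaloisMap,
    toAdd_ofAdd, toAdd_ofAdd, toAdd_logEquiv_scalarAut, map_mul, hc]

/-- In particular for scalars from `k`: `(algebraMap k k̄ t) · (σ x) = σ ((algebraMap k k̄ t) · x)`.
[claim: Mochizuki2012, status: disputed] (IUTchII §1 Ex 1.8 (iv), kurims p.39) -/
theorem scalarAut_unitsModTorsionGaloisMap_of_algebraMap (σ : K ≃ₐ[k] K) (c : Kˣ) (t : k)
    (hc : (c : K) = algebraMap k K t) (x : unitGroup k K ⧸ CommGroup.torsion (unitGroup k K)) :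
    L.scalarAut c (unitsModTorsionGaloisMap σ x) = unitsModTorsionGaloisMap σ (L.scalarAut c x) :=
  L.scalarAut_unitsModTorsionGaloisMap σ c (by rw [hc, AlgEquiv.commutes]) x

/-- `scalarAut` is injective: `k~ ≅ (k̄, +)` is a faithful `k̄`-module (`c · log_k̄⁻¹(1) = log_k̄⁻¹(c)`).
[claim: Mochizuki2012, status: disputed] (IUTchII §1 Rmk 1.11.1 (i), kurims p.50) -/
theorem scalarAut_injective : Function.Injective L.scalarAut := by
  intro c d hcd
  have h := congrArg (fun φ => Multiplicative.toAdd (L.logEquiv (φ (L.logEquiv.symm (Multiplicative.ofAdd 1)))))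
    hcd
  simp only [toAdd_logEquiv_scalarAut, MulEquiv.apply_symm_apply, toAdd_ofAdd, mul_one] at h
  exact Units.ext h

end GaloisPadicLog

/-! ## In `ℚ̄_p`: `log_p(𝒪_{ℚ_p(x)}^×)` is `ℤ_p`-stable -/

section PadicAlgCl

variable (p : ℕ) [hp : Fact p.Prime]

/-- **In `ℚ̄_p`**: for `x` of absolute value `1` and `a ∈ ℤ_p` there is `y ∈ ℚ_p(x)` of absolute value `1`
with `log y = a · log x` (Iwasawa logarithm `padicLogAlgCl`) — because `log_p(𝒪_E^×)`, `E = ℚ_p(x)`, is a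
compact hence `ℤ_p`-stable subgroup of `E` (abc-iut-S1's `smul_mem_logUnits`) and `log_k̄|_E = log_p`
(`coe_unitLog_eq_padicLogAlgCl`). [cite: MochizukiAbsTopIII2015, Proposition 3.3 (ii) p.74] -/
theorem PadicAlgCl.exists_mem_adjoin_norm_eq_one_log_eq_mul (x : PadicAlgCl p) (hx : ‖x‖ = 1) (a : ℤ_[p]) :
    ∃ y : PadicAlgCl p, y ∈ IntermediateField.adjoin ℚ_[p] ({x} : Set (PadicAlgCl p)) ∧ ‖y‖ = 1 ∧
      padicLogAlgCl p y = algebraMap ℚ_[p] (PadicAlgCl p) (a : ℚ_[p]) * padicLogAlgCl p x := by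
  set E := IntermediateField.adjoin ℚ_[p] ({x} : Set (PadicAlgCl p)) with hE
  have hxint : IsIntegral ℚ_[p] x := (Algebra.IsAlgebraic.isAlgebraic x).isIntegral
  haveI : FiniteDimensional ℚ_[p] E := IntermediateField.adjoin.finiteDimensional hxint
  set x' : E := ⟨x, IntermediateField.mem_adjoin_simple_self ℚ_[p] x⟩ with hx'
  have hx'n : ‖x'‖ = 1 := hx
  -- `log_p x' ∈ log_p(𝒪_E^×)`, a `ℤ_p`-submodule of `E` (abc-iut-S1's scoped `Algebra ℤ_[p] E`)
  have hmem := smul_mem_logUnits p E a (unitLog_mem_logUnits hx'n)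
  obtain ⟨w, hw, hweq⟩ := hmem
  refine ⟨(w : PadicAlgCl p), w.2, hw, ?_⟩
  rw [← coe_unitLog_eq_padicLogAlgCl p E hw, hweq]
  change ((algebraMap ℚ_[p] E (a : ℚ_[p]) * unitLog x' : E) : PadicAlgCl p) = _
  rw [IntermediateField.coe_mul, coe_unitLog_eq_padicLogAlgCl p E hx'n]
  rfl

end PadicAlgCl

/-! ## Every `MLFClosure`: the lattice lemma for `log_k̄` -/

namespace MLFClosure

variable (C : MLFClosure.{0})

section ResidueChar

variable (p : ℕ) [hp : Fact p.Prime]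

/-- **The lattice lemma for `log_k̄`, at a residue characteristic `p`**: for a unit `x ∈ 𝒪_k̄^×` and `a ∈ ℤ_p`
there is a unit `y ∈ 𝒪_k̄^× ∩ k(x)` with `log_k̄ y = a · log_k̄ x` (scalar `a` through `ℚ_p → k → k̄`). Proof:
transport of the `ℚ̄_p` statement along the `k`-isomorphism `k̄ ≃ ℚ̄_p` through which
`galoisPadicLogOfResidueChar` is DEFINED. [cite: MochizukiAbsTopIII2015, Proposition 3.3 (ii) p.74] -/
theorem exists_mem_adjoin_unit_log_eq_mul_ofResidueChar (hpk : valuation C.k p < 1) {x : C.K}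
    (hx : x ∈ unitSubmonoid C.k C.K) (a : ℤ_[p]) :
    ∃ y : C.K, y ∈ IntermediateField.adjoin C.k ({x} : Set C.K) ∧ y ∈ unitSubmonoid C.k C.K ∧
      (C.galoisPadicLogOfResidueChar p hpk).log y =
        algebraMap C.k C.K (LocalField.padicRingHom C.k p hpk (a : ℚ_[p])) *
          (C.galoisPadicLogOfResidueChar p hpk).log x := by
  letI iQk : Algebra ℚ_[p] C.k := LocalField.padicAlgebra C.k p hpk
  letI iQK : Algebra ℚ_[p] C.K := ((algebraMap C.k C.K).comp (LocalField.padicRingHom C.k p hpk)).toAlgebra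
  haveI : IsScalarTower ℚ_[p] C.k C.K := IsScalarTower.of_algebraMap_eq fun _ => rfl
  haveI : FiniteDimensional ℚ_[p] C.k :=
    Literature.NumberTheory.PAdicHodge.PadicBase.instFiniteDimensional (F := C.k) (p := p) hpk
  haveI : IsAlgClosure ℚ_[p] C.K :=
    { isAlgClosed := IsAlgClosure.isAlgClosed C.k
      isAlgebraic := C.isAlgebraic_padic_K p hpk }
  let e : C.K ≃ₐ[ℚ_[p]] PadicAlgCl p := IsAlgClosure.equiv ℚ_[p] C.K (PadicAlgCl p)
  letI ikA : Algebra C.k (PadicAlgCl p) := (e.toAlgHom.toRingHom.comp (algebraMap C.k C.K)).toAlgebra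
  haveI hST : IsScalarTower ℚ_[p] C.k (PadicAlgCl p) := IsScalarTower.of_algebraMap_eq fun c => by
    change algebraMap ℚ_[p] (PadicAlgCl p) c = e (algebraMap C.k C.K (algebraMap ℚ_[p] C.k c))
    rw [← IsScalarTower.algebraMap_apply ℚ_[p] C.k C.K, AlgEquiv.commutes]
  let e' : C.K ≃ₐ[C.k] PadicAlgCl p :=
    { e.toRingEquiv with commutes' := fun _ => rfl }
  -- the logarithm of `galoisPadicLogOfResidueChar` is, by definition, the transport of `padicLogAlgCl` along `e'`
  have hlog : ∀ z : C.K, (C.galoisPadicLogOfResidueChar p hpk).log z = e'.symm (padicLogAlgCl p (e' z)) :=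
    fun _ => rfl
  -- the unit `x` goes to an element of `ℚ̄_p` of absolute value `1`
  have hxu : e' x ∈ unitSubmonoid C.k (PadicAlgCl p) := (mem_unitSubmonoid_algEquiv_iff e' x).mpr hx
  have hxn : ‖e' x‖ = 1 := (mem_unitSubmonoid_iff_norm_eq_one_of_isNonarchimedeanLocalField p (e' x)).mp hxu
  obtain ⟨y', hy'E, hy'n, hy'log⟩ := PadicAlgCl.exists_mem_adjoin_norm_eq_one_log_eq_mul p (e' x) hxn a
  -- `ℚ_p(e' x) ⊆ e'(k(x))`
  have hle : IntermediateField.adjoin ℚ_[p] ({e' x} : Set (PadicAlgCl p)) ≤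
      ((IntermediateField.adjoin C.k ({x} : Set C.K)).map e'.toAlgHom).restrictScalars ℚ_[p] := by
    rw [IntermediateField.adjoin_simple_le_iff, IntermediateField.mem_restrictScalars, IntermediateField.mem_map]
    exact ⟨x, IntermediateField.mem_adjoin_simple_self C.k x, rfl⟩
  have hy'map : y' ∈ (IntermediateField.adjoin C.k ({x} : Set C.K)).map e'.toAlgHom := hle hy'E
  rw [IntermediateField.mem_map] at hy'map
  obtain ⟨t, ht, hty'⟩ := hy'map
  have hty : e'.symm y' = t := by
    rw [← hty']
    exact e'.symm_apply_apply t
  refine ⟨e'.symm y', hty ▸ ht, ?_, ?_⟩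
  · exact (mem_unitSubmonoid_algEquiv_iff e' _).mp (by
      rw [AlgEquiv.apply_symm_apply]
      exact (mem_unitSubmonoid_iff_norm_eq_one_of_isNonarchimedeanLocalField p y').mpr hy'n)
  · rw [hlog, hlog, AlgEquiv.apply_symm_apply, hy'log, map_mul]
    congr 1
    rw [IsScalarTower.algebraMap_apply ℚ_[p] C.k (PadicAlgCl p), AlgEquiv.commutes]
    rfl

end ResidueChar

/-- The residue characteristic `p` of the MLF `k` (the characteristic of the residue field `𝓀[k]`; a prime by
`ringChar_residueField_prime`). [cite: MochizukiAbsTopIII2015, Definition 3.1 (i) p.66] -/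
abbrev residueChar : ℕ := ringChar 𝓀[C.k]

/-- The residue characteristic is a prime (`Fact` form, to be supplied with `haveI`).
[cite: MochizukiAbsTopIII2015, Definition 3.1 (i) p.66] -/
theorem fact_residueChar_prime : Fact C.residueChar.Prime := ⟨C.ringChar_residueField_prime⟩

variable [Fact C.residueChar.Prime]

/-- **The lattice lemma for THE logarithm `log_k̄` of an `MLFClosure`** (`MLFClosure.galoisPadicLog`, at the
residue characteristic): for `x ∈ 𝒪_k̄^×` and `a ∈ ℤ_p` there is `y ∈ 𝒪_k̄^× ∩ k(x)` with `log_k̄ y = a · log_k̄ x`.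
[cite: MochizukiAbsTopIII2015, Proposition 3.3 (ii) p.74] -/
theorem exists_mem_adjoin_unit_log_eq_mul {x : C.K} (hx : x ∈ unitSubmonoid C.k C.K) (a : ℤ_[C.residueChar]) :
    ∃ y : C.K, y ∈ IntermediateField.adjoin C.k ({x} : Set C.K) ∧ y ∈ unitSubmonoid C.k C.K ∧
      C.galoisPadicLog.log y =
        algebraMap C.k C.K (LocalField.padicRingHom C.k C.residueChar C.valuation_ringChar_lt_one (a : ℚ_[C.residueChar])) *
          C.galoisPadicLog.log x :=
  C.exists_mem_adjoin_unit_log_eq_mul_ofResidueChar C.residueChar C.valuation_ringChar_lt_one hx a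

/-! ## The `ℤ_p^×`-powers on `k~` -/

/-- The scalar `a ∈ ℤ_p` in `k̄`, through `ℤ_p ⊆ ℚ_p → k → k̄` (the canonical embedding `padicRingHom` of a
mixed-characteristic local field). [cite: MochizukiAbsTopIII2015, Definition 3.1 (i) p.66] -/
def padicScalar : ℤ_[C.residueChar] →+* C.K :=
  (algebraMap C.k C.K).comp ((LocalField.padicRingHom C.k C.residueChar C.valuation_ringChar_lt_one).comp
    PadicInt.Coe.ringHom)

/-- Unfolding lemma for `padicScalar`. [cite: MochizukiAbsTopIII2015, Definition 3.1 (i) p.66] -/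
theorem padicScalar_apply (a : ℤ_[C.residueChar]) :
    C.padicScalar a =
      algebraMap C.k C.K (LocalField.padicRingHom C.k C.residueChar C.valuation_ringChar_lt_one (a : ℚ_[C.residueChar])) :=
  rfl

/-- `padicScalar` is injective (a ring homomorphism from a domain... into a field, through injective maps).
[cite: MochizukiAbsTopIII2015, Definition 3.1 (i) p.66] -/
theorem padicScalar_injective : Function.Injective C.padicScalar :=
  (algebraMap C.k C.K).injective.comp
    ((LocalField.padicRingHom C.k C.residueChar C.valuation_ringChar_lt_one).injective.comp
      fun _ _ h => PadicInt.ext h)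

/-- Every `σ ∈ G_k` fixes the scalars from `ℤ_p` (they lie in `k`). [cite: MochizukiAbsTopIII2015, Definition 3.1 (i) p.66] -/
theorem galois_padicScalar (σ : C.K ≃ₐ[C.k] C.K) (a : ℤ_[C.residueChar]) : σ (C.padicScalar a) = C.padicScalar a := by
  rw [padicScalar_apply, AlgEquiv.commutes]

/-- The scalar `a ∈ ℤ_p^×` as a unit of `k̄`. [cite: MochizukiAbsTopIII2015, Definition 3.1 (i) p.66] -/
def padicScalarUnits : ℤ_[C.residueChar]ˣ →* (C.K)ˣ := Units.map C.padicScalar.toMonoidHom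

/-- Unfolding lemma for `padicScalarUnits`. [cite: MochizukiAbsTopIII2015, Definition 3.1 (i) p.66] -/
@[simp] theorem coe_padicScalarUnits (a : ℤ_[C.residueChar]ˣ) :
    ((C.padicScalarUnits a : (C.K)ˣ) : C.K) = C.padicScalar a := rfl

/-- **The `ℤ_p^×`-powers `x ↦ x^a` on `k~ = 𝒪_k̄^× ⧸ 𝒪_k̄^μ`** ("there is a natural action of `Ẑ^×` on `M`",
[AbsTopIII] Prop. 3.3 (ii) p. 74, factoring on `k~` through `Ẑ^× ↠ ℤ_p^×`; [IUTchII] Ex. 1.8 (iv) p. 39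
"`Ẑ^× ↠ ℤ_p^× ↪ Ism`"): DEFINED through `log_k̄` as `x^a := log_k̄⁻¹ (a · log_k̄ x)`.
[claim: Mochizuki2012, status: disputed] (IUTchII §1 Ex 1.8 (iv), kurims p.39) -/
def zpPow : ℤ_[C.residueChar]ˣ →* MulAut (unitGroup C.k C.K ⧸ CommGroup.torsion (unitGroup C.k C.K)) :=
  C.galoisPadicLog.scalarAut.comp C.padicScalarUnits

/-- **`log_k̄ (x^a) = a · log_k̄ x`**. [claim: Mochizuki2012, status: disputed] (IUTchII §1 Ex 1.8 (iv), kurims p.39) -/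
theorem toAdd_logEquiv_zpPow (a : ℤ_[C.residueChar]ˣ) (x : unitGroup C.k C.K ⧸ CommGroup.torsion (unitGroup C.k C.K)) :
    Multiplicative.toAdd (C.logEquiv (C.zpPow a x)) = C.padicScalar a * Multiplicative.toAdd (C.logEquiv x) :=
  C.galoisPadicLog.toAdd_logEquiv_scalarAut (C.padicScalarUnits a) x

/-- **The `ℤ_p^×`-powers are `G_k`-equivariant**: `(σ x)^a = σ (x^a)` on `k~`.
[claim: Mochizuki2012, status: disputed] (IUTchII §1 Ex 1.8 (iv), kurims p.39) -/
theorem zpPow_unitsModTorsionGaloisMap (a : ℤ_[C.residueChar]ˣ) (σ : C.K ≃ₐ[C.k] C.K)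
    (x : unitGroup C.k C.K ⧸ CommGroup.torsion (unitGroup C.k C.K)) :
    C.zpPow a (unitsModTorsionGaloisMap σ x) = unitsModTorsionGaloisMap σ (C.zpPow a x) :=
  C.galoisPadicLog.scalarAut_unitsModTorsionGaloisMap σ (C.padicScalarUnits a) (C.galois_padicScalar σ a) x

/-- **`ℤ_p^× ↪ Aut(k~)`**: distinct `p`-adic units give distinct powers.
[claim: Mochizuki2012, status: disputed] (IUTchII §1 Ex 1.8 (iv), kurims p.39) -/
theorem zpPow_injective : Function.Injective C.zpPow := fun a b hab => by
  have h := C.galoisPadicLog.scalarAut_injective hab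
  exact Units.ext (C.padicScalar_injective (by simpa using congrArg (fun u : (C.K)ˣ => (u : C.K)) h))

/-- **THE LATTICE LEMMA in `k~`**: for every subgroup `H ⊆ G_k` (in particular every OPEN one), the lattice
"image of `(𝒪_k̄^×)^H` in `k~`" is carried into itself by every `ℤ_p^×`-power: for `u ∈ 𝒪_k̄^×` fixed by `H` and
`a ∈ ℤ_p^×` there is `v ∈ 𝒪_k̄^×` fixed by `H` with `[u]^a = [v]` (take `v ∈ k(u)` with `log_k̄ v = a · log_k̄ u`).
[claim: Mochizuki2012, status: disputed] (IUTchII §1 Ex 1.8 (iv), kurims p.39) -/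
theorem exists_fixed_zpPow_mk_eq_mk (H : Subgroup (C.K ≃ₐ[C.k] C.K)) (u : unitGroup C.k C.K)
    (hu : ∀ σ ∈ H, σ ((u : (C.K)ˣ) : C.K) = ((u : (C.K)ˣ) : C.K)) (a : ℤ_[C.residueChar]ˣ) :
    ∃ v : unitGroup C.k C.K, (∀ σ ∈ H, σ ((v : (C.K)ˣ) : C.K) = ((v : (C.K)ˣ) : C.K)) ∧
      C.zpPow a (QuotientGroup.mk u) = QuotientGroup.mk v := by
  obtain ⟨y, hyF, hyu, hylog⟩ := C.exists_mem_adjoin_unit_log_eq_mul u.2 (a : ℤ_[C.residueChar])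
  obtain ⟨v, hv⟩ := exists_unitGroup_val_eq hyu
  -- `k(u)` is fixed pointwise by `H`
  have hFle : IntermediateField.adjoin C.k ({((u : (C.K)ˣ) : C.K)} : Set C.K) ≤ IntermediateField.fixedField H := by
    rw [IntermediateField.adjoin_simple_le_iff]
    exact fun σ => hu σ σ.2
  refine ⟨v, fun σ hσ => ?_, ?_⟩
  · rw [hv]
    exact (IntermediateField.mem_fixedField_iff H y).mp (hFle hyF) σ hσ
  · apply C.logEquiv.injective
    apply Multiplicative.toAdd.injective
    rw [toAdd_logEquiv_zpPow, logEquiv_mk, logEquiv_mk, toAdd_ofAdd, toAdd_ofAdd, hv, hylog, padicScalar_apply]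

end MLFClosure

end Literature.AnabelianGeometry.AbsoluteAnabelian

end
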